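/-
Copyright (c) 2026 the pub-hodgecm-mathlib formalisation cell (harness21).  Prover seat hodgecm-mathlib-F0P2-p02 (g25); E1 keeper ∕ dealer F0P3a-p03 (g29), E1 BRICK
LEDGER row 40 «K2′-π² SELF-EXTENSION ASSEMBLY modulo (ND) @ DATUM», generic spine G1 (census `F0/P2/p02/g25/k2pi2/CENSUS-K2PI2-SELFEXT.v1` eb22afb6).
-/
import Literature.RepresentationTheory.JetWindowTransfer   -- ★ row 32 p853122: `not_fills_of_not_deforms` (brings rows 21 ∕ 26, `OneCocycleExtension`)
import HarnessLib

/-!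
# Jet-embedding exclusion: under first-order NON-degeneracy of `A ≤ π₀`, every equivariant map into the jet module whose sub-sources map into `A`
# has ZERO first component («no extension of `A` by pieces of `A` embeds transversally into the first-order thickening»)

Generic representation theory over a commutative ring `k` (any monoid `G`), Mathlib-only on top of the tree's ★ `JetWindowTransfer` (row 32), THEOREMS ONLY
(no `def`, no instance, no notation, no named fact, no `sorry`).  Letters of ★ `FirstOrderJetIntertwiner` ∕ `FirstOrderDeformationInvariantSubspace` ∕ `JetWindowTransfer`:
`π₀ : Representation k G V`, a first-order deformation `π₁` (`h1 : π₁ 1 = 0`, Leibniz `hL`), its JET MODULE `ρ` on `V × V` (`hρ : ρ g (v₀, v₁) = (π₀ g v₀, π₁ g v₀ + π₀ g v₁)`),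
a `π₀`-invariant `A ≤ V` (`hAinv`), and **(ND) = «`A` does NOT deform to first order along `(π₀, π₁)`»** in row 32's letters VERBATIM
(`hnd : ¬ ∃ L : A →ₗ V, ∀ g a, π₁ g a + π₀ g (L a) - L (π₀|_A g a) ∈ A`).  A representation `τ` on `X` and a `k`-linear `φ : X → V × V` equivariant into the jet
(`hφ : φ (τ g x) = ρ g (φ x)`).  Cell `pub/hodgecm-mathlib`, crux H413 = `stmt-HodgeConjecture-24833` (`--supports` lane), E1 BRICK LEDGER (F0P3a-p03 (g29)) row 40, generic spine
G1 of the census `CENSUS-K2PI2-SELFEXT.v1` (F0P2-p02 (g25)): the datum file only has to produce such a `φ` (from Frobenius reciprocity into `i_B(N_λ) ≅` the jet module, ★ J1∕J2)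
to conclude.

* §1 THE TWO `G`-MAPS OUT OF `φ`: `fst ∘ φ` intertwines `τ` with `π₀` (`fst_apply_equivariant`); on the `τ`-INVARIANT kernel `{x | (φ x).1 = 0}` (`ker_fst_comp_invariant`)
  the second component intertwines with `π₀` too (`snd_apply_equivariant_of_fst_eq_zero`) — because `ρ g (0, v₁) = (0, π₀ g v₁)`.
* §2 **`window_of_forall_apply_mem`**: if every equivariant `k`-linear map from a `τ`-invariant submodule `X′ ≤ X` to `V` takes values in `A` (hypothesis `hrange`, plain
  letters: `∀ X′, (∀ g, X′ ≤ X′.comap (τ g)) → ∀ f : X′ →ₗ V, (∀ g x, f ⟨τ g x, _⟩ = π₀ g (f x)) → ∀ x, f x ∈ A`), then `φ` satisfies row 32's WINDOW hypotheses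
  `hA : ∀ x, (φ x).1 ∈ A` and `hmeet : ∀ x, (φ x).1 = 0 → (φ x).2 ∈ A`.
* §3 **`fill_of_irreducible`**: if `A` is `π₀`-IRREDUCIBLE among invariant submodules (`hAirr : ∀ B ≤ A, (∀ g, B ≤ B.comap (π₀ g)) → B = ⊥ ∨ B = A`), `hA` holds and
  `(φ x₀).1 ≠ 0` for some `x₀`, then the first components FILL `A` (`∀ a ∈ A, ∃ x, (φ x).1 = a`): `range (fst ∘ φ)` is a non-zero invariant submodule of `A`.
* §4 **`forall_fst_eq_zero_of_not_deforms`** (THE EXCLUSION): under (ND), `A` projective and irreducible, and `hrange`, EVERY such `φ` has `(φ x).1 = 0` for all `x` — by ★ row 32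
  `not_fills_of_not_deforms` against §2–§3.  Corollary **`not_exists_equivariant_jet_of_not_deforms`**: there is NO pair `(τ, φ)` with `hrange` and some `(φ x).1 ≠ 0`.
  No injectivity of `φ` is needed.  USE (row 40, census §0): for a self-extension `E` of an irreducible constituent `A ⊂ I₀ = π₀` with `Hom_G(A, I₀ ∕ A) = 0`, every `G`-map
  from a subrepresentation of `E` to `I₀` lands in `A` (length-two bookkeeping), so (ND) forbids any equivariant `E → jet(I₀, π₁)` with non-zero first projection — which is what
  Frobenius reciprocity produces when `r_B E` is the NON-split self-extension `N_λ` of `χ`; hence `r_B E ≅ χ ⊕ χ` and `E` splits by the Hom-count.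

SOURCES (what is formalised, read at our letters).  [HuybrechtsLehn1997, App. 2.A.7 (Flags of subsheaves)]: first-order deformations of a sub-object `A ⊂ V` along a given
first-order deformation of `V` exist iff the off-diagonal block (a 1-cocycle with values in `Hom(A, V∕A)`) is a coboundary — §4 is its contrapositive read on maps INTO the
thickening `V × V = V[ε]∕ε²`: a `G`-module mapping equivariantly into `V[ε]∕ε²` with image inside the window `A + εV` and meeting `εV` inside `εA` projects onto a complement of
`ε(V∕A)` in the window quotient, i.e. a first-order deformation of `A`.  [Brown1982, Ch. IV §2, Prop. 2.1 p. 87 and Prop. 2.3 p. 89]: complements in a split extension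
`A ⋊ G` ↔ derivations, conjugate complements ↔ principal derivations — the cocycle∕coboundary dictionary used by rows 21∕26∕32 underneath.  Deliberately NOT here: induced
representations, Jacquet modules, the unitary group, or the analytic sentence (ND) itself (it stays a hypothesis; [Keys1984] proves it for the case the cell needs).
-/

set_option autoImplicit false

namespace Literature.RepresentationTheory

variable {k : Type*} [CommRing k] {G : Type*} [Monoid G] {V : Type*} [AddCommGroup V] [Module k V]
variable {X : Type*} [AddCommGroup X] [Module k X]

/-! ## §1 The two `G`-maps out of an equivariant map into the jet module -/

/-- **`fst ∘ φ` IS EQUIVARIANT INTO `π₀`**: `(φ (τ g x)).1 = π₀ g (φ x).1` (the jet module surjects onto `π₀` by the first projection).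
[cite: HuybrechtsLehn1997, App. 2.A.7 (Flags of subsheaves)] -/
theorem fst_apply_equivariant (π₀ : Representation k G V) (π₁ : G → Module.End k V) (ρ : Representation k G (V × V))
    (hρ : ∀ g v₀ v₁, ρ g (v₀, v₁) = (π₀ g v₀, π₁ g v₀ + π₀ g v₁))
    (τ : Representation k G X) (φ : X →ₗ[k] V × V) (hφ : ∀ g x, φ (τ g x) = ρ g (φ x)) (g : G) (x : X) :
    (φ (τ g x)).1 = π₀ g (φ x).1 := by
  rw [hφ, ← Prod.mk.eta (p := φ x), hρ]

/-- **ON THE KERNEL OF `fst ∘ φ` THE SECOND COMPONENT IS EQUIVARIANT INTO `π₀`** and the kernel is stable: if `(φ x).1 = 0` then `(φ (τ g x)).1 = 0` and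
`(φ (τ g x)).2 = π₀ g (φ x).2` (the sub `0 × V` of the jet module is `π₀`). [cite: HuybrechtsLehn1997, App. 2.A.7 (Flags of subsheaves)] -/
theorem snd_apply_equivariant_of_fst_eq_zero (π₀ : Representation k G V) (π₁ : G → Module.End k V) (ρ : Representation k G (V × V))
    (hρ : ∀ g v₀ v₁, ρ g (v₀, v₁) = (π₀ g v₀, π₁ g v₀ + π₀ g v₁))
    (τ : Representation k G X) (φ : X →ₗ[k] V × V) (hφ : ∀ g x, φ (τ g x) = ρ g (φ x)) (g : G) (x : X) (hx : (φ x).1 = 0) :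
    (φ (τ g x)).1 = 0 ∧ (φ (τ g x)).2 = π₀ g (φ x).2 := by
  have h : φ (τ g x) = (π₀ g 0, π₁ g 0 + π₀ g (φ x).2) := by
    rw [hφ, ← Prod.mk.eta (p := φ x), hx, hρ]
  refine ⟨?_, ?_⟩
  · rw [h, map_zero]
  · rw [h, map_zero, map_zero, zero_add]

/-- **THE KERNEL OF `fst ∘ φ` IS `τ`-INVARIANT.** [cite: HuybrechtsLehn1997, App. 2.A.7 (Flags of subsheaves)] -/
theorem ker_fst_comp_invariant (π₀ : Representation k G V) (π₁ : G → Module.End k V) (ρ : Representation k G (V × V))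
    (hρ : ∀ g v₀ v₁, ρ g (v₀, v₁) = (π₀ g v₀, π₁ g v₀ + π₀ g v₁))
    (τ : Representation k G X) (φ : X →ₗ[k] V × V) (hφ : ∀ g x, φ (τ g x) = ρ g (φ x)) (g : G) :
    LinearMap.ker (LinearMap.fst k V V ∘ₗ φ) ≤ (LinearMap.ker (LinearMap.fst k V V ∘ₗ φ)).comap (τ g) := by
  intro x hx
  rw [Submodule.mem_comap, LinearMap.mem_ker, LinearMap.comp_apply, LinearMap.fst_apply]
  rw [LinearMap.mem_ker, LinearMap.comp_apply, LinearMap.fst_apply] at hx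
  exact (snd_apply_equivariant_of_fst_eq_zero π₀ π₁ ρ hρ τ φ hφ g x hx).1

/-! ## §2 The window hypotheses from «every `G`-map from a sub-source lands in `A`» -/

/-- **WINDOW FROM RANGE CONTROL.**  If every equivariant `k`-linear map from a `τ`-invariant submodule of `X` to `V` takes values in `A`, then an equivariant `φ : X → V × V` into the
jet module lands in the window over `A` (`(φ x).1 ∈ A`) and meets `0 × V` only inside `0 × A` (`(φ x).1 = 0 → (φ x).2 ∈ A`): apply the hypothesis to `fst ∘ φ` on `X` and to
`snd ∘ φ` on the kernel of `fst ∘ φ` (§1). [cite: HuybrechtsLehn1997, App. 2.A.7 (Flags of subsheaves)] [cite: Brown1982, Ch. IV §2 Prop. 2.1 p. 87] -/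
theorem window_of_forall_apply_mem (π₀ : Representation k G V) (π₁ : G → Module.End k V) (ρ : Representation k G (V × V))
    (hρ : ∀ g v₀ v₁, ρ g (v₀, v₁) = (π₀ g v₀, π₁ g v₀ + π₀ g v₁)) (A : Submodule k V)
    (τ : Representation k G X) (φ : X →ₗ[k] V × V) (hφ : ∀ g x, φ (τ g x) = ρ g (φ x))
    (hrange : ∀ (X' : Submodule k X) (hX' : ∀ g, X' ≤ X'.comap (τ g)) (f : X' →ₗ[k] V),
      (∀ (g : G) (x : X'), f ⟨τ g x, hX' g x.2⟩ = π₀ g (f x)) → ∀ x, f x ∈ A) :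
    (∀ x, (φ x).1 ∈ A) ∧ ∀ x, (φ x).1 = 0 → (φ x).2 ∈ A := by
  refine ⟨fun x => ?_, fun x hx => ?_⟩
  · -- `fst ∘ φ` on the invariant submodule `⊤`
    have h := hrange ⊤ (fun g x _ => Submodule.mem_top) ((LinearMap.fst k V V ∘ₗ φ) ∘ₗ (⊤ : Submodule k X).subtype)
      (fun g y => by
        show (φ (τ g y)).1 = π₀ g (φ y).1
        exact fst_apply_equivariant π₀ π₁ ρ hρ τ φ hφ g y) ⟨x, Submodule.mem_top⟩
    exact h
  · -- `snd ∘ φ` on the invariant kernel of `fst ∘ φ`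
    have hxK : x ∈ LinearMap.ker (LinearMap.fst k V V ∘ₗ φ) := by
      rw [LinearMap.mem_ker, LinearMap.comp_apply, LinearMap.fst_apply]
      exact hx
    have h := hrange (LinearMap.ker (LinearMap.fst k V V ∘ₗ φ)) (ker_fst_comp_invariant π₀ π₁ ρ hρ τ φ hφ)
      ((LinearMap.snd k V V ∘ₗ φ) ∘ₗ (LinearMap.ker (LinearMap.fst k V V ∘ₗ φ)).subtype)
      (fun g y => by
        have hy : (φ (y : X)).1 = 0 := by
          have := y.2
          rw [LinearMap.mem_ker, LinearMap.comp_apply, LinearMap.fst_apply] at this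
          exact this
        show (φ (τ g y)).2 = π₀ g (φ y).2
        exact (snd_apply_equivariant_of_fst_eq_zero π₀ π₁ ρ hρ τ φ hφ g y hy).2) ⟨x, hxK⟩
    exact h

/-! ## §3 Filling from irreducibility -/

/-- **FILLING FROM IRREDUCIBILITY.**  If `A` has no invariant submodules other than `⊥` and `A`, the first components of `φ` lie in `A`, and some first component is non-zero, then the
first components FILL `A`: `range (fst ∘ φ)` is an invariant submodule of `A` (by §1) and is not `⊥`. [cite: HuybrechtsLehn1997, App. 2.A.7 (Flags of subsheaves)] -/
theorem fill_of_irreducible (π₀ : Representation k G V) (π₁ : G → Module.End k V) (ρ : Representation k G (V × V))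
    (hρ : ∀ g v₀ v₁, ρ g (v₀, v₁) = (π₀ g v₀, π₁ g v₀ + π₀ g v₁)) (A : Submodule k V)
    (hAirr : ∀ B : Submodule k V, B ≤ A → (∀ g, B ≤ B.comap (π₀ g)) → B = ⊥ ∨ B = A)
    (τ : Representation k G X) (φ : X →ₗ[k] V × V) (hφ : ∀ g x, φ (τ g x) = ρ g (φ x)) (hA : ∀ x, (φ x).1 ∈ A)
    (hne : ∃ x₀, (φ x₀).1 ≠ 0) : ∀ a ∈ A, ∃ x, (φ x).1 = a := by
  -- the range of `fst ∘ φ`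
  have hB := hAirr (LinearMap.range (LinearMap.fst k V V ∘ₗ φ)) (by
      rintro v ⟨x, rfl⟩
      exact hA x) (fun g => by
      rintro v ⟨x, rfl⟩
      rw [Submodule.mem_comap]
      refine ⟨τ g x, ?_⟩
      show (φ (τ g x)).1 = π₀ g (φ x).1
      exact fst_apply_equivariant π₀ π₁ ρ hρ τ φ hφ g x)
  rcases hB with hbot | hA'
  · obtain ⟨x₀, hx₀⟩ := hne
    exact absurd ((Submodule.eq_bot_iff _).1 hbot (φ x₀).1 ⟨x₀, rfl⟩) hx₀
  · intro a ha
    rw [← hA'] at ha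
    obtain ⟨x, hx⟩ := ha
    exact ⟨x, hx⟩

/-! ## §4 The exclusion -/

/-- **JET-EMBEDDING EXCLUSION.**  Let `A ≤ V` be `π₀`-invariant, projective over `k`, irreducible among invariant submodules, and NOT deformable to first order along `(π₀, π₁)`
((ND), row 32's `hnd` verbatim).  Then every equivariant `φ : X → V × V` into the jet module, from ANY representation `τ` all of whose invariant submodules map equivariantly into
`V` only inside `A` (`hrange`), has ZERO first component: `(φ x).1 = 0` for all `x`.  Proof: otherwise §2–§3 give row 32's `hA`, `hmeet`, `hfill`, contradicting
★ `not_fills_of_not_deforms`. [cite: HuybrechtsLehn1997, App. 2.A.7 (Flags of subsheaves)] [cite: Brown1982, Ch. IV §2 Prop. 2.3 p. 89] -/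
theorem forall_fst_eq_zero_of_not_deforms (π₀ : Representation k G V) (π₁ : G → Module.End k V) (h1 : π₁ 1 = 0)
    (hL : ∀ g h, π₁ (g * h) = π₁ g * π₀ h + π₀ g * π₁ h) (ρ : Representation k G (V × V))
    (hρ : ∀ g v₀ v₁, ρ g (v₀, v₁) = (π₀ g v₀, π₁ g v₀ + π₀ g v₁)) (A : Submodule k V) [Module.Projective k A]
    (hAinv : ∀ g, A ≤ A.comap (π₀ g))
    (hAirr : ∀ B : Submodule k V, B ≤ A → (∀ g, B ≤ B.comap (π₀ g)) → B = ⊥ ∨ B = A)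
    (hnd : ¬ ∃ L : A →ₗ[k] V, ∀ g (a : A), π₁ g (a : V) + π₀ g (L a) - L (π₀.subrepresentation A hAinv g a) ∈ A)
    (τ : Representation k G X) (φ : X →ₗ[k] V × V) (hφ : ∀ g x, φ (τ g x) = ρ g (φ x))
    (hrange : ∀ (X' : Submodule k X) (hX' : ∀ g, X' ≤ X'.comap (τ g)) (f : X' →ₗ[k] V),
      (∀ (g : G) (x : X'), f ⟨τ g x, hX' g x.2⟩ = π₀ g (f x)) → ∀ x, f x ∈ A)
    (x : X) : (φ x).1 = 0 := by
  by_contra hx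
  obtain ⟨hA, hmeet⟩ := window_of_forall_apply_mem π₀ π₁ ρ hρ A τ φ hφ hrange
  have hfill := fill_of_irreducible π₀ π₁ ρ hρ A hAirr τ φ hφ hA ⟨x, hx⟩
  obtain ⟨a, ha, hno⟩ := not_fills_of_not_deforms π₀ π₁ h1 hL ρ hρ A hAinv hnd τ φ hφ hA hmeet
  obtain ⟨y, hy⟩ := hfill a ha
  exact hno y hy

/-- **COROLLARY — NO TRANSVERSAL EQUIVARIANT MAP INTO THE JET.**  Under (ND) (with `A` projective, invariant, irreducible) there is no representation `τ` with an equivariant `φ` into the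
jet module satisfying `hrange` and having a non-zero first component. [cite: HuybrechtsLehn1997, App. 2.A.7 (Flags of subsheaves)] -/
theorem not_exists_equivariant_jet_of_not_deforms (π₀ : Representation k G V) (π₁ : G → Module.End k V) (h1 : π₁ 1 = 0)
    (hL : ∀ g h, π₁ (g * h) = π₁ g * π₀ h + π₀ g * π₁ h) (ρ : Representation k G (V × V))
    (hρ : ∀ g v₀ v₁, ρ g (v₀, v₁) = (π₀ g v₀, π₁ g v₀ + π₀ g v₁)) (A : Submodule k V) [Module.Projective k A]
    (hAinv : ∀ g, A ≤ A.comap (π₀ g))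
    (hAirr : ∀ B : Submodule k V, B ≤ A → (∀ g, B ≤ B.comap (π₀ g)) → B = ⊥ ∨ B = A)
    (hnd : ¬ ∃ L : A →ₗ[k] V, ∀ g (a : A), π₁ g (a : V) + π₀ g (L a) - L (π₀.subrepresentation A hAinv g a) ∈ A) :
    ¬ ∃ (τ : Representation k G X) (φ : X →ₗ[k] V × V), (∀ g x, φ (τ g x) = ρ g (φ x)) ∧
      (∀ (X' : Submodule k X) (hX' : ∀ g, X' ≤ X'.comap (τ g)) (f : X' →ₗ[k] V),
        (∀ (g : G) (x : X'), f ⟨τ g x, hX' g x.2⟩ = π₀ g (f x)) → ∀ x, f x ∈ A) ∧ ∃ x, (φ x).1 ≠ 0 := by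
  rintro ⟨τ, φ, hφ, hrange, x, hx⟩
  exact hx (forall_fst_eq_zero_of_not_deforms π₀ π₁ h1 hL ρ hρ A hAinv hAirr hnd τ φ hφ hrange x)

end Literature.RepresentationTheory
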